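import Literature.Computability.Learning.NaturalLearningPredictor
import Literature.Computability.MetaComplexity.NWDesignAC0Mod
import Literature.Computability.MetaComplexity.SmolenskyNaturalProperty
import HarnessLib

/-!
# The NW outputs of the `AC⁰[2]` learner are small `AC⁰[2]` circuits, hence fail the natural property

Groundwork for the named fact `Literature.Computability.Learning.cikk_learn_AC0Mod` (CIKK 2016
Cor. 5.4), case `p = 2`: the step "`g_z ∈ Λ[s_g]` … by usefulness `¬D(g_z) = 1`" of the proof of
CIKK Thm. 5.1 (with Thm. 3.2: nonuniform `AC⁰[p]`-efficiency of the black-box generator), for the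
amplified function `AMP(f) = (f^k)^{GL}` over `𝔽₂` of `NaturalLearningPredictor.lean` (CIKK
Thm. 4.3) composed with the `AC⁰[2]`-computable NW design of `NWDesignAC0Mod.lean` (CIKK Thm. 3.7):

* `ampFn_eq_modGate` — the Goldreich–Levin bit `⟨f^k(x⃗), r⟩` is one parity gate on the `k` bits
  `f(xᵢ) ∧ rᵢ`;
* **`acRealOver_ampFnFin_design`** — for `f` computed by a circuit `C` over `{¬, ∧, ∨, ⊕}` and any
  seed `z`, the NW output `g_z : v ↦ AMP(f)(z|_{S_v})` is realized over `accBasis 2` at depth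
  `acDepth C + 6` with `k · (|C| + (n+1) · coordSize + 1) + 1` gates (Fig. 1 of CIKK: the design
  circuit under `k` copies of `C`, an `∧` layer and a parity gate);
* **`ampNW_not_mem_rsProperty`** — consequently (usefulness of the Razborov–Smolensky property,
  `not_mem_rsProperty_of_computes'` of `SmolenskyNaturalProperty.lean`) every such `g_z` is
  REJECTED by `rsProperty 2` at length `ℓ` as soon as `64 ℓ'^{2(d+6)} ≤ oddFloor ℓ` and
  `16 · size < 2^{ℓ'}` for some `ℓ' ≥ 1` — the `AC⁰[2]` replacement for the circuit-size test
  `GoodLevel` of the `P/poly` learner (`LearnerLevel.lean`).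

All statements are proved; no named facts are introduced.

## References

* M. Carmosino, R. Impagliazzo, V. Kabanets, A. Kolokolova, *Learning algorithms from natural
  proofs*, CCC 2016, LIPIcs 50, Thm. 3.2 (nonuniform `Λ`-efficiency), Thm. 3.7, Thm. 4.3, Thm. 5.1
  (proof), Fig. 1 [CarmosinoImpagliazzoKabanetsKolokolova2016].
-/

namespace Literature.Computability.Learning

open Finset Literature.Computability.Complexity Literature.Computability.MetaComplexity
  Literature.Computability.MetaComplexity.GFDesign Literature.Computability.MetaComplexity.Smolensky
  Literature.Computability.Cryptography

variable {n k : ℕ}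

/-! ### The Goldreich–Levin bit is a parity gate -/

/-- Casting a count of Booleans to `𝔽₂`. [folklore] -/
theorem natCast_card_filter_eq_sum (g : Fin k → Bool) :
    (((univ.filter fun i => g i = true).card : ℕ) : ZMod 2) = ∑ i, if g i = true then (1 : ZMod 2) else 0 := by
  rw [Finset.card_filter, Nat.cast_sum]
  refine Finset.sum_congr rfl fun i _ => ?_
  split_ifs <;> simp

/-- **`⟨f^k(x⃗), r⟩ = ⊕ᵢ (f(xᵢ) ∧ rᵢ)`**: the amplified function is one parity gate on `k` conjunctions.
[cite: CarmosinoImpagliazzoKabanetsKolokolova2016, Thm. 4.3 (proof: "(f^k)^{GL} is of size at most the additive term O(k) larger")] -/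
theorem ampFn_eq_modGate (f : (Fin n → Bool) → Bool) (w : AmpIdx n k → Bool) :
    ampFn f k w = (GateFn.modGate 2 k).2 fun i => f (blocksOf w i) && w (Sum.inr i) := by
  set g : Fin k → Bool := fun i => f (blocksOf w i) && w (Sum.inr i) with hg
  have hsum : dpGL f (blocksOf w, maskOf w) = ((GateFn.numOnes g : ℕ) : ZMod 2) := by
    unfold GateFn.numOnes
    rw [natCast_card_filter_eq_sum, dpGL]
    change ∑ i, dpVec f (blocksOf w) i * maskOf w i = _
    refine Finset.sum_congr rfl fun i _ => ?_
    simp only [dpVec, maskOf, boolToZMod, hg]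
    cases f (blocksOf w i) <;> cases w (Sum.inr i) <;> simp
  change decide (dpGL f (blocksOf w, maskOf w) = 1) = decide (GateFn.numOnes g % 2 ≠ 0)
  rw [hsum]
  have h2 : ∀ N : ℕ, ((N : ZMod 2) = 1) ↔ N % 2 ≠ 0 := by
    intro N
    rw [← ZMod.natCast_mod N 2]
    rcases Nat.mod_two_eq_zero_or_one N with h | h <;> rw [h] <;> decide
  simp only [h2]

/-! ### The NW output of the learner as an `AC⁰[2]` circuit -/

variable {K : Type*} [Field K] [DecidableEq K] [Fintype K] [Algebra (ZMod 2) K] {t ℓ : ℕ}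

/-- A conjunction of two realized functions. [folklore] -/
theorem acRealOver_and₂ {B : Set GateFn} (hB : acBasis ⊆ B) {ι : Type*} {g h : (ι → Bool) → Bool}
    {d sg sh : ℕ} (hg : ACRealOver B g d sg) (hh : ACRealOver B h d sh) :
    ACRealOver B (fun x => g x && h x) (d + 1) (sg + sh + 1) := by
  have hfam : ∀ m : Fin 2, ACRealOver B (![g, h] m) d (![sg, sh] m) := by
    intro m
    fin_cases m
    · exact hg
    · exact hh
  refine ((acRealOver_forall hB hfam).mono le_rfl (le_of_eq (by simp))).congr fun x => ?_
  simp only [Fin.forall_fin_two, Matrix.cons_val_zero, Matrix.cons_val_one, Bool.decide_and,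
    Bool.decide_eq_true]

/-- **The NW output `g_z(v) = AMP(f)(z|_{S_v})` is a small `AC⁰[2]` circuit** (CIKK Fig. 1 with
Thm. 3.7 and Thm. 4.3): for `f` computed by the circuit `C` over `accBasis 2`, the polynomial
design over `K ⊇ 𝔽₂` (`t` coordinates) with evaluation points `A`, and any seed `z`, the function
`v ↦ AMP(f)(pos ↦ z(S_v(pos)))` is realized over `accBasis 2` at depth `acDepth C + 6` with
`k · (|C| + (n+1)·coordSize |K| t ℓ 2 + 1) + 1` gates.
[cite: CarmosinoImpagliazzoKabanetsKolokolova2016, Thm. 3.2 (proof: nonuniform AC⁰[p]-efficiency)] -/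
theorem acRealOver_ampFnFin_design (b : Module.Basis (Fin t) (ZMod 2) K) (A : Fin (k * n + k) ↪ K)
    (C : Circuit (Fin n)) (hC : C.IsOver (accBasis 2)) (z : K × K → Bool) :
    ACRealOver (accBasis 2)
      (fun v : Fin ℓ → Bool => ampFnFin (fun x => C.eval x) k fun pos => z (design A ℓ v pos))
      (C.acDepth + 6) (k * (C.size + (n + 1) * coordSize (Fintype.card K) t ℓ 2 + 1) + 1) := by
  set S₄ := coordSize (Fintype.card K) t ℓ 2 with hS₄
  set e := ampIdxEquiv n k with he
  have hcoord : ∀ pos : Fin (k * n + k),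
      ACRealOver (accBasis 2) (fun v : Fin ℓ → Bool => z (design A ℓ v pos)) 4 S₄ :=
    fun pos => acRealOver_design b A z pos
  -- one block `f(x_i(v))` and its mask bit
  have hblock : ∀ i : Fin k, ACRealOver (accBasis 2)
      (fun v : Fin ℓ → Bool => C.eval (fun j => z (design A ℓ v (e (Sum.inl (i, j))))) &&
        z (design A ℓ v (e (Sum.inr i))))
      (C.acDepth + 5) (C.size + (n + 1) * S₄ + 1) := by
    intro i
    have hX := acRealOver_circuit_comp C hC (fun j => hcoord (e (Sum.inl (i, j))))
    have hR := (hcoord (e (Sum.inr i))).mono (Nat.le_add_left 4 C.acDepth) le_rfl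
    refine ((acRealOver_and₂ (acBasis_subset_accBasis 2) hX hR).mono le_rfl (le_of_eq ?_)).congr fun v => rfl
    simp only [Finset.sum_const, Finset.card_univ, Fintype.card_fin, smul_eq_mul]
    ring
  have hgate := acRealOver_gate (ι := Fin ℓ) (B := accBasis 2) (GateFn.modGate 2 k)
    (modGate_mem_accBasis 2 k) (d := C.acDepth + 5) (s := fun _ => C.size + (n + 1) * S₄ + 1) hblock
  refine (hgate.mono le_rfl (le_of_eq ?_)).congr fun v => ?_
  · simp only [Finset.sum_const, Finset.card_univ, Fintype.card_fin, smul_eq_mul]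
    rfl
  · rw [ampFnFin, ampFn_eq_modGate]
    rfl

/-- **Every NW output of the `AC⁰[2]` learner is rejected by the Razborov–Smolensky property**
(CIKK, proof of Thm. 5.1: "by usefulness, `Pr_z[¬D(g_z) = 1] = 1`", here for `Λ = AC⁰[2]` with the
property `rsProperty 2` and explicit parameters): if `f` has a circuit over `accBasis 2` of
`acDepth ≤ d` and size `≤ s`, then for every seed `z` the output `g_z` at length `ℓ ≥ 1` is not in
`rsProperty 2 ℓ`, provided some `ℓ' ≥ 1` has `64 ℓ'^{2(d+6)} ≤ oddFloor ℓ` and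
`16 · (k(s + (n+1)·coordSize + 1) + 1) < 2^{ℓ'}`.
[cite: CarmosinoImpagliazzoKabanetsKolokolova2016, Thm. 5.1 (proof)] -/
theorem ampNW_not_mem_rsProperty (b : Module.Basis (Fin t) (ZMod 2) K) (A : Fin (k * n + k) ↪ K)
    (C : Circuit (Fin n)) (hC : C.IsOver (accBasis 2)) {d s : ℕ} (hd : C.acDepth ≤ d) (hs : C.size ≤ s)
    (z : K × K → Bool) (hℓ : 1 ≤ ℓ) {ℓ' : ℕ} (hℓ' : 1 ≤ ℓ')
    (hdeg : 64 * ℓ' ^ (2 * (d + 6)) ≤ oddFloor ℓ)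
    (hsize : 16 * (k * (s + (n + 1) * coordSize (Fintype.card K) t ℓ 2 + 1) + 1) < 2 ^ ℓ') :
    (fun v : Fin ℓ → Bool => ampFnFin (fun x => C.eval x) k fun pos => z (design A ℓ v pos)) ∉
      rsProperty 2 ℓ := by
  have hreal := (acRealOver_ampFnFin_design b A C hC z).mono (Nat.add_le_add_right hd 6)
    (show k * (C.size + (n + 1) * coordSize (Fintype.card K) t ℓ 2 + 1) + 1 ≤
        k * (s + (n + 1) * coordSize (Fintype.card K) t ℓ 2 + 1) + 1 by gcongr)
  obtain ⟨C', hO, hD, hS, hcomp⟩ := hreal.toCircuit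
  refine not_mem_rsProperty_of_computes' (p := 2) hℓ C' hO hD hcomp hℓ' ?_ ?_
  · simpa using hdeg
  · exact lt_of_le_of_lt (Nat.mul_le_mul_left 16 hS) hsize

end Literature.Computability.Learning
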